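import Mathlib
import Literature.Analysis.FluidPDE.HardSphereCollisionRecord
import Literature.Analysis.FluidPDE.HardSphereFlowMeasurable
import Literature.Analysis.FluidPDE.HardSphereFlowJointMeasurable
import Literature.MathematicalPhysics.KineticTheory.HardSphereEuler
import Literature.MathematicalPhysics.KineticTheory.HardSphereEulerProofs
import Summits.AtomisticToContinuum.HydrodynamicLimit.Theorems.OneFlightGossipEngineOneFlightLayeredChaosRegimes
import Summits.AtomisticToContinuum.HydrodynamicLimit.Theorems.OneFlightGossipEngineOneFlightLayeredChaosDiscRegimes
import Summits.AtomisticToContinuum.HydrodynamicLimit.Theorems.OneFlightGossipEngineOneFlightLayeredChaosDiscTransfer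
import Summits.AtomisticToContinuum.HydrodynamicLimit.Theorems.OneFlightGossipEngineOneFlightLayeredChaosDiscFlatBundle
import Summits.AtomisticToContinuum.HydrodynamicLimit.Theorems.OneFlightGossipEngineOneFlightLayeredChaosTransQuasiInv
import Summits.AtomisticToContinuum.HydrodynamicLimit.Theorems.OneFlightGossipEngineOneFlightLayeredChaosNoWrapThreshold
import Summits.AtomisticToContinuum.HydrodynamicLimit.Theorems.OneFlightGossipEngineOneFlightLayeredChaosCoarsePast
import Summits.AtomisticToContinuum.HydrodynamicLimit.Theorems.OneFlightGossipEngineOneFlightLayeredChaosLaterFlightStart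
import HarnessLib

/-!
# `OneFlightGossipEngine.OneFlightLayeredChaos` — translation quasi-invariance ⇒ disc form, on every regime
(crux stmt-AtomisticToContinuum-14535, line `Sketch`, lead cycle c3; TransQuasiInv layer 3/3; registered stub
`regimeDiscBody_of_transQuasiInv`)

The transfer from the line's TRANSLATION QUASI-INVARIANCE frame (`…TransQuasiInv.lean`, `OLC.RegimeTransQuasiInvBody`)
to its DISC-FORM frame (`…DiscRegimes.lean`, `OLC.RegimeDiscBody`): if, given the coarse past, on the regime `X`, the
joint law of the incoming direction proxy `ĝ` and of the transverse offset `b` of the colliding pair at the later flight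
start is invariant up to `C σ^p` under translations of `b` inside the unit disc of `ĝ^⊥`, then `b` is uniform on that
disc given the coarse past up to `38 C σ^p` — for EVERY regime `X`; no measurability of `X` is needed, and the
no-wrap-around input is the landed `noWrap_of_threshold` at threshold `1/8`.
(1) MEASURABLE VERSIONS: `ĝ` and `b` restricted to `Φ.good` are measurable (`measurable_coarsePastOf_nthPartnerOf_restrict`,
    flight starts + joint measurability of the flow `measurable_flow_prod_torus`, `Torus.isMeasurable_geometry`), so their
    modifications `ĝ', b'` by `0` off `Φ.good` are measurable; `P (Φ.good)ᶜ = 0`; the arbitrary set `X ∩ E` is replaced by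
    its measurable hull (`Measure.restrict_toMeasurable`) and `W` by `Φ.good ∩ W` — all the (outer) measures and set
    integrals of the two frames are unchanged (`measure_inter_congr_of_symmDiff_null`, `Measure.restrict_congr_set`).
(2) KINEMATICS: on `Φ.good ∩ W` off the long-path event `L = {∃ k, path ≥ 1/8}`, `‖ĝ‖ = 1` and `b = ω − ⟪ω, ĝ⟫ ĝ` lies in
    the OPEN unit disc of `ĝ^⊥` (`sepVec_laterFlightStart_eq`, `inv_smul_tangential_sub_smul`, `⟪ω, ĝ⟫ < 0` by
    `stub_record_geometry` + `stub_preVel_eq_flightStart_vel`); `P(goodᶜ ∪ L) ≤ C σ^p` for `N ≥ N₁` (`noWrap_of_threshold`).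
(3) BRICK: `disc_flat_bundle_of_quasiInvariant` (`…DiscFlatBundle.lean`) for `(P, (Φ.good ∩ W) ∩ hull, ĝ', b')` with
    error `C σ^p` gives `36 C σ^p`; removing the disc constraint from the event and from the compensator costs `C σ^p`
    each by (2). Constants `C ↦ 38 C`, `σ₀ ↦ min σ₀ ¼`, `N₀ ↦ max N₀ N₁`.
-/

open scoped BigOperators ENNReal
open MeasureTheory Set
open Literature.Analysis.FluidPDE Literature.MathematicalPhysics.KineticTheory

namespace Summit.AtomisticToContinuum.HydrodynamicLimit.Theorems.OLC

noncomputable section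

/-! ## Measurability of the three events of the frames along measurable fields -/

/-- The disc event `{(g, b) ∈ S, b ∈ D_g}` along measurable `g, b` is measurable. [folklore] -/
theorem measurableSet_discEvent {Ω : Type*} [MeasurableSpace Ω] {g b : Ω → V3} (hg : Measurable g) (hb : Measurable b)
    {S : Set (V3 × V3)} (hS : MeasurableSet S) :
    MeasurableSet {z | (g z, b z) ∈ S ∧ (inner ℝ (b z) (g z) = 0 ∧ ‖b z‖ < 1)} := by
  have h2 : MeasurableSet {z | inner ℝ (b z) (g z) = 0 ∧ ‖b z‖ < 1} := measurableSet_discBundle.preimage (hg.prodMk hb)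
  rw [Set.setOf_and]
  exact ((hg.prodMk hb) hS).inter h2

/-- The backward-shift event `{(g, b) ∈ S, b ∈ D_g, b − Π_g δ ∈ D_g}` along measurable `g, b` is measurable. [folklore] -/
theorem measurableSet_shiftEvent₁ {Ω : Type*} [MeasurableSpace Ω] {g b : Ω → V3} (hg : Measurable g) (hb : Measurable b)
    (δ : V3) {S : Set (V3 × V3)} (hS : MeasurableSet S) :
    MeasurableSet {z | (g z, b z) ∈ S ∧ (inner ℝ (b z) (g z) = 0 ∧ ‖b z‖ < 1) ∧
      (inner ℝ (b z - (δ - inner ℝ δ (g z) • g z)) (g z) = 0 ∧ ‖b z - (δ - inner ℝ δ (g z) • g z)‖ < 1)} := by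
  have hin : Measurable fun z => inner ℝ δ (g z) := measurable_const.inner hg
  have hpr : Measurable fun z => b z - (δ - inner ℝ δ (g z) • g z) := hb.sub (measurable_const.sub (hin.smul hg))
  have h2 : MeasurableSet {z | inner ℝ (b z) (g z) = 0 ∧ ‖b z‖ < 1} := measurableSet_discBundle.preimage (hg.prodMk hb)
  have h3 : MeasurableSet {z | inner ℝ (b z - (δ - inner ℝ δ (g z) • g z)) (g z) = 0 ∧
      ‖b z - (δ - inner ℝ δ (g z) • g z)‖ < 1} := measurableSet_discBundle.preimage (hg.prodMk hpr)
  rw [Set.setOf_and, Set.setOf_and]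
  exact ((hg.prodMk hb) hS).inter (h2.inter h3)

/-- The forward-shift event `{(g, b + Π_g δ) ∈ S, b + Π_g δ ∈ D_g, b ∈ D_g}` along measurable `g, b` is measurable. [folklore] -/
theorem measurableSet_shiftEvent₂ {Ω : Type*} [MeasurableSpace Ω] {g b : Ω → V3} (hg : Measurable g) (hb : Measurable b)
    (δ : V3) {S : Set (V3 × V3)} (hS : MeasurableSet S) :
    MeasurableSet {z | (g z, b z + (δ - inner ℝ δ (g z) • g z)) ∈ S ∧
      (inner ℝ (b z + (δ - inner ℝ δ (g z) • g z)) (g z) = 0 ∧ ‖b z + (δ - inner ℝ δ (g z) • g z)‖ < 1) ∧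
      (inner ℝ (b z) (g z) = 0 ∧ ‖b z‖ < 1)} := by
  have hin : Measurable fun z => inner ℝ δ (g z) := measurable_const.inner hg
  have hpr : Measurable fun z => b z + (δ - inner ℝ δ (g z) • g z) := hb.add (measurable_const.sub (hin.smul hg))
  have h2 : MeasurableSet {z | inner ℝ (b z) (g z) = 0 ∧ ‖b z‖ < 1} := measurableSet_discBundle.preimage (hg.prodMk hb)
  have h3 : MeasurableSet {z | inner ℝ (b z + (δ - inner ℝ δ (g z) • g z)) (g z) = 0 ∧
      ‖b z + (δ - inner ℝ δ (g z) • g z)‖ < 1} := measurableSet_discBundle.preimage (hg.prodMk hpr)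
  rw [Set.setOf_and, Set.setOf_and]
  exact ((hg.prodMk hpr) hS).inter (h3.inter h2)

/-- **The tangential part of the impact vector lies in the open unit disc of `ĝ^⊥`**: for unit `ω, g` with
`⟪ω, g⟫ < 0`, `b = ω − ⟪ω, g⟫ g` satisfies `⟪b, g⟫ = 0` and `‖b‖ < 1`. [folklore] -/
theorem tangential_mem_openDisc (ω g : V3) (hω : ‖ω‖ = 1) (hg : ‖g‖ = 1) (hin : inner ℝ ω g < 0) :
    inner ℝ (ω - inner ℝ ω g • g) g = 0 ∧ ‖ω - inner ℝ ω g • g‖ < 1 := by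
  constructor
  · rw [inner_sub_left, real_inner_smul_left, real_inner_self_eq_norm_sq, hg]
    ring
  · have hsq : ‖ω - inner ℝ ω g • g‖ ^ 2 = 1 - inner ℝ ω g ^ 2 := by
      rw [norm_sub_sq_real, hω, real_inner_smul_right, norm_smul, hg, mul_one, Real.norm_eq_abs, sq_abs]
      ring
    have hpos : 0 < inner ℝ ω g ^ 2 := by rw [sq]; exact mul_pos_of_neg_of_neg hin hin
    nlinarith [norm_nonneg (ω - inner ℝ ω g • g)]

/-! ## The transfer -/

/-- **Translation quasi-invariance ⇒ disc form, on every regime** (registered stub `regimeDiscBody_of_transQuasiInv`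
of crux stmt-AtomisticToContinuum-14535, line `Sketch`). If, given the coarse past, on the regime `X`, the joint law of
the incoming direction proxy and of the transverse offset of the colliding pair at the later flight start is invariant
up to `C σ^p` in `L¹(𝒢)` under translations of the offset inside the unit disc of `ĝ^⊥` (`RegimeTransQuasiInvBody θ₀ X`),
then that offset is uniform on the disc given the coarse past up to `38 C σ^p` on `X` (`RegimeDiscBody θ₀ X`): the
bundle-form brick `disc_flat_bundle_of_quasiInvariant` applied to measurable versions of `(ĝ, b)` on
`(Φ.good ∩ W) ∩ hull(X ∩ E)`, plus the no-wrap-around input `noWrap_of_threshold` at threshold `1/8` to put `b` in the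
disc almost surely. [folklore] -/
theorem regimeDiscBody_of_transQuasiInv : ∀ {θ₀ : ℝ}, 0 < θ₀ → ∀ X : Summit.AtomisticToContinuum.HydrodynamicLimit.Theorems.OLC.Regime, Summit.AtomisticToContinuum.HydrodynamicLimit.Theorems.OLC.RegimeTransQuasiInvBody θ₀ X → Summit.AtomisticToContinuum.HydrodynamicLimit.Theorems.OLC.RegimeDiscBody θ₀ X := by
  intro θ₀ hθ X h
  obtain ⟨C, hC, p, hp, σ₀, hσ₀, hcore⟩ := h
  refine ⟨38 * C, by positivity, p, hp, min σ₀ 4⁻¹, lt_min hσ₀ (by norm_num), fun σ hσ hσlt => ?_⟩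
  have hσ₀' : σ < σ₀ := hσlt.trans_le (min_le_left _ _)
  have hσ4 : σ < 4⁻¹ := hσlt.trans_le (min_le_right _ _)
  have hσ2 : σ ≤ 2⁻¹ := by linarith
  intro τ hτ n
  obtain ⟨N₀, hN₀⟩ := hcore σ hσ hσ₀' τ hτ n
  have hη : 0 < C * σ ^ p := by positivity
  obtain ⟨N₁, hN₁⟩ := noWrap_of_threshold hθ (by norm_num : (0 : ℝ) < 8⁻¹) hσ hσ2 hτ hη
  refine ⟨max N₀ N₁, fun N hN Φ i S hS => ?_⟩
  intro G ε w q P W gIn sPlus bOff E hE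
  classical
  have hεpos : 0 < ε := hsDiameter_pos hσ N
  have hε4 : ε < 4⁻¹ := (hsDiameter_le hσ.le N).trans_lt hσ4
  have hε2 : ε < 2⁻¹ := hε4.trans (by norm_num)
  haveI : IsProbabilityMeasure P :=
    isProbabilityMeasure_localGibbsLaw continuous_const continuous_const continuous_const
      (fun _ => one_pos) (fun _ => hθ) (by linarith) N Φ
  have hnull : P Φ.goodᶜ = 0 := localGibbsLaw_one_compl_good σ θ₀ N Φ
  set η : ℝ := C * σ ^ p with hηdef
  -- the translation quasi-invariance hypothesis at this `(N, Φ, i, E)`, lets unfolded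
  have hTQI : ∀ (δ : V3) (S' : Set (V3 × V3)), MeasurableSet S' →
      |(P (W ∩ {z | (gIn z, bOff z) ∈ S' ∧ (inner ℝ (bOff z) (gIn z) = 0 ∧ ‖bOff z‖ < 1) ∧
          (inner ℝ (bOff z - (δ - inner ℝ δ (gIn z) • gIn z)) (gIn z) = 0 ∧
            ‖bOff z - (δ - inner ℝ δ (gIn z) • gIn z)‖ < 1)} ∩ (X σ n N Φ i ∩ E))).toReal -
        (P (W ∩ {z | (gIn z, bOff z + (δ - inner ℝ δ (gIn z) • gIn z)) ∈ S' ∧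
          (inner ℝ (bOff z + (δ - inner ℝ δ (gIn z) • gIn z)) (gIn z) = 0 ∧
            ‖bOff z + (δ - inner ℝ δ (gIn z) • gIn z)‖ < 1) ∧
          (inner ℝ (bOff z) (gIn z) = 0 ∧ ‖bOff z‖ < 1)} ∩ (X σ n N Φ i ∩ E))).toReal| ≤ η :=
    fun δ S' hS' => hN₀ N ((le_max_left _ _).trans hN) Φ i δ S' hS' E hE
  -- the long-path event and the no-wrap-around input
  set L : Set (Config (N + 1) (Fin 3) T3) := {z | ∃ k : Fin (N + 1), ENNReal.ofReal 8⁻¹ ≤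
      ∫⁻ t in Set.Ioc 0 w, ENNReal.ofReal ‖(Φ.flow t z k).2‖} with hLdef
  have hL : P L ≤ ENNReal.ofReal η := hN₁ N ((le_max_right _ _).trans hN) Φ
  have hbad : (P (Φ.goodᶜ ∪ L)).toReal ≤ η := by
    have : P (Φ.goodᶜ ∪ L) ≤ ENNReal.ofReal η :=
      (measure_union_le _ _).trans (by rw [hnull, zero_add]; exact hL)
    exact ENNReal.toReal_le_of_le_ofReal hη.le this
  -- (2) kinematics: on `good ∩ W`, `‖ĝ‖ = 1`; off `L` moreover `b` lies in the open unit disc of `ĝ^⊥`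
  set ω : Config (N + 1) (Fin 3) T3 → V3 := fun z => (Φ.nthRecordOf i n z).impactVec with hωdef
  have hgeom : ∀ z ∈ Φ.good, z ∈ W → ‖ω z‖ = 1 ∧ ‖gIn z‖ = 1 ∧ inner ℝ (ω z) (gIn z) < 0 := by
    intro z hz hzW
    obtain ⟨h1, h2, h3, -⟩ := stub_record_geometry hεpos hε2 Φ i n w hz hzW
    have hpre := stub_preVel_eq_flightStart_vel hεpos hε2 Φ q i n w hz hzW
    have hin : (Φ.nthRecordOf i n z).inDir = gIn z := by
      change _ = ‖((Φ.coarsePastOf q i n z).1 i).2 - ((Φ.coarsePastOf q i n z).2 (Φ.nthPartnerOf i n z)).2‖⁻¹ •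
        (((Φ.coarsePastOf q i n z).1 i).2 - ((Φ.coarsePastOf q i n z).2 (Φ.nthPartnerOf i n z)).2)
      rw [HardSphereCollisionRecord.inDir, hpre]
    exact ⟨h1, by rw [← hin]; exact h2, by rw [← hin]; exact h3⟩
  have hdisc : ∀ z ∈ Φ.good, z ∈ W → z ∉ L → inner ℝ (bOff z) (gIn z) = 0 ∧ ‖bOff z‖ < 1 := by
    intro z hzg hzW hzL
    obtain ⟨h1, h2, h3⟩ := hgeom z hzg hzW
    have hshort : ∀ k : Fin (N + 1), ∫⁻ t in Set.Ioc 0 w, ENNReal.ofReal ‖(Φ.flow t z k).2‖ < ENNReal.ofReal 8⁻¹ := by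
      intro k
      by_contra hk
      exact hzL ⟨k, not_lt.1 hk⟩
    have hkin := sepVec_laterFlightStart_eq hεpos hε4 Φ q i n w hzg hzW hshort
    set gd : V3 := ((Φ.coarsePastOf q i n z).1 i).2 - ((Φ.coarsePastOf q i n z).2 (Φ.nthPartnerOf i n z)).2
      with hgd
    have hgIn : gIn z = ‖gd‖⁻¹ • gd := rfl
    have hQ : G.sepVec (Φ.flow (sPlus z) z i).1 (Φ.flow (sPlus z) z (Φ.nthPartnerOf i n z)).1 =
        ε • ω z - (Φ.nthCollisionTimeOf i n z - sPlus z) • gd := hkin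
    have heq : bOff z = ω z - inner ℝ (ω z) (gIn z) • gIn z := by
      calc bOff z = ε⁻¹ • (G.sepVec (Φ.flow (sPlus z) z i).1 (Φ.flow (sPlus z) z (Φ.nthPartnerOf i n z)).1 -
            inner ℝ (G.sepVec (Φ.flow (sPlus z) z i).1 (Φ.flow (sPlus z) z (Φ.nthPartnerOf i n z)).1) (gIn z) •
              gIn z) := rfl
        _ = ε⁻¹ • ((ε • ω z - (Φ.nthCollisionTimeOf i n z - sPlus z) • gd) -
            inner ℝ (ε • ω z - (Φ.nthCollisionTimeOf i n z - sPlus z) • gd) (‖gd‖⁻¹ • gd) • (‖gd‖⁻¹ • gd)) := by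
              rw [hQ, hgIn]
        _ = ω z - inner ℝ (ω z) (‖gd‖⁻¹ • gd) • (‖gd‖⁻¹ • gd) := inv_smul_tangential_sub_smul _ _ _ hεpos.ne'
        _ = ω z - inner ℝ (ω z) (gIn z) • gIn z := by rw [← hgIn]
    rw [heq]
    exact tangential_mem_openDisc _ _ h1 h2 h3
  -- (1) measurable versions of `ĝ` and `b`
  have hFmap := measurable_coarsePastOf_nthPartnerOf_restrict Φ (rhoStar σ * ((N + 1 : ℕ) : ℝ) ^ (-(1 / 3 : ℝ))) i n
  have hgInm : Measurable fun z : Φ.good => gIn z := by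
    have hφ : Measurable fun c : ((Fin (N + 1) → (Fin 3 → ℤ) × V3) × (Fin (N + 1) → (Fin 3 → ℤ) × V3)) × Fin (N + 1) =>
        (c.1.1 i).2 - (c.1.2 c.2).2 := by
      have h1 : Measurable fun c : ((Fin (N + 1) → (Fin 3 → ℤ) × V3) × (Fin (N + 1) → (Fin 3 → ℤ) × V3)) ×
          Fin (N + 1) => (c.1.1 i).2 := ((measurable_pi_apply i).comp measurable_fst.fst).snd
      have h2 : Measurable fun c : ((Fin (N + 1) → (Fin 3 → ℤ) × V3) × (Fin (N + 1) → (Fin 3 → ℤ) × V3)) ×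
          Fin (N + 1) => (c.1.2 c.2).2 :=
        measurable_from_prod_countable_left fun j => ((measurable_pi_apply j).comp measurable_snd).snd
      exact h1.sub h2
    have hΔ : Measurable fun z : Φ.good => ((Φ.coarsePastOf q i n z).1 i).2 -
        ((Φ.coarsePastOf q i n z).2 (Φ.nthPartnerOf i n z)).2 := hφ.comp hFmap
    exact hΔ.norm.inv.smul hΔ
  have hsPlusm : Measurable fun z : Φ.good => sPlus z :=
    (measurable_flightStart_nthCollisionTimeOf_restrict Φ i i n).max (measurable_flightStart_partner_restrict Φ i n)
  have hflowm : Measurable fun z : Φ.good => Φ.flow (sPlus z) (z : Config (N + 1) (Fin 3) T3) :=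
    Φ.measurable_flow_prod_torus.comp (measurable_id.prodMk hsPlusm)
  have hxi : Measurable fun z : Φ.good => (Φ.flow (sPlus z) (z : Config (N + 1) (Fin 3) T3) i).1 :=
    ((measurable_pi_apply i).comp hflowm).fst
  have hxj : Measurable fun z : Φ.good =>
      (Φ.flow (sPlus z) (z : Config (N + 1) (Fin 3) T3) (Φ.nthPartnerOf i n z)).1 := by
    have hev : Measurable fun c : Config (N + 1) (Fin 3) T3 × Fin (N + 1) => (c.1 c.2).1 :=
      measurable_from_prod_countable_left fun j => (measurable_pi_apply j).fst
    exact hev.comp (hflowm.prodMk (measurable_nthPartnerOf_restrict Φ i n))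
  have hQm : Measurable fun z : Φ.good => G.sepVec (Φ.flow (sPlus z) (z : Config (N + 1) (Fin 3) T3) i).1
      (Φ.flow (sPlus z) (z : Config (N + 1) (Fin 3) T3) (Φ.nthPartnerOf i n z)).1 :=
    Torus.isMeasurable_geometry.measurable_sepVec.comp (hxi.prodMk hxj)
  have hinm : Measurable fun z : Φ.good => inner ℝ (G.sepVec (Φ.flow (sPlus z) (z : Config (N + 1) (Fin 3) T3) i).1
      (Φ.flow (sPlus z) (z : Config (N + 1) (Fin 3) T3) (Φ.nthPartnerOf i n z)).1) (gIn z) := hQm.inner hgInm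
  have hb1m : Measurable fun z : Φ.good => G.sepVec (Φ.flow (sPlus z) (z : Config (N + 1) (Fin 3) T3) i).1
      (Φ.flow (sPlus z) (z : Config (N + 1) (Fin 3) T3) (Φ.nthPartnerOf i n z)).1 -
      inner ℝ (G.sepVec (Φ.flow (sPlus z) (z : Config (N + 1) (Fin 3) T3) i).1
        (Φ.flow (sPlus z) (z : Config (N + 1) (Fin 3) T3) (Φ.nthPartnerOf i n z)).1) (gIn z) • gIn z :=
    hQm.sub (hinm.smul hgInm)
  have hb2m : Measurable fun z : Φ.good => ε⁻¹ • (G.sepVec (Φ.flow (sPlus z) (z : Config (N + 1) (Fin 3) T3) i).1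
      (Φ.flow (sPlus z) (z : Config (N + 1) (Fin 3) T3) (Φ.nthPartnerOf i n z)).1 -
      inner ℝ (G.sepVec (Φ.flow (sPlus z) (z : Config (N + 1) (Fin 3) T3) i).1
        (Φ.flow (sPlus z) (z : Config (N + 1) (Fin 3) T3) (Φ.nthPartnerOf i n z)).1) (gIn z) • gIn z) :=
    hb1m.const_smul ε⁻¹
  have hbOffm : Measurable fun z : Φ.good => bOff z := hb2m
  have hgInm' : Measurable (Φ.good.restrict gIn) := hgInm
  have hbOffm' : Measurable (Φ.good.restrict bOff) := hbOffm
  set g' : Config (N + 1) (Fin 3) T3 → V3 := Φ.good.piecewise gIn (fun _ => 0) with hg'def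
  set b' : Config (N + 1) (Fin 3) T3 → V3 := Φ.good.piecewise bOff (fun _ => 0) with hb'def
  have hg'm : Measurable g' := measurable_piecewise_const_of_measurable_restrict Φ.measurableSet_good hgInm' 0
  have hb'm : Measurable b' := measurable_piecewise_const_of_measurable_restrict Φ.measurableSet_good hbOffm' 0
  have hg'eq : ∀ z ∈ Φ.good, g' z = gIn z := fun z hz => Set.piecewise_eq_of_mem _ _ _ hz
  have hb'eq : ∀ z ∈ Φ.good, b' z = bOff z := fun z hz => Set.piecewise_eq_of_mem _ _ _ hz
  -- (1) the measurable base event `F = (good ∩ W) ∩ hull(X ∩ E)`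
  set F₀ : Set (Config (N + 1) (Fin 3) T3) := X σ n N Φ i ∩ E with hF₀
  set Fm : Set (Config (N + 1) (Fin 3) T3) := toMeasurable P F₀ with hFm
  have hFmm : MeasurableSet Fm := measurableSet_toMeasurable P F₀
  have hresF : P.restrict Fm = P.restrict F₀ := Measure.restrict_toMeasurable (measure_ne_top P F₀)
  have hW' : MeasurableSet (Φ.good ∩ W) := measurableSet_good_inter_le_ncard_collisionTimesOf Φ i (n + 1) w
  set F : Set (Config (N + 1) (Fin 3) T3) := (Φ.good ∩ W) ∩ Fm with hFdef
  have hFm' : MeasurableSet F := hW'.inter hFmm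
  have hunit : ∀ z ∈ F, ‖g' z‖ = 1 := fun z hz => by
    rw [hg'eq z hz.1.1]
    exact (hgeom z hz.1.1 hz.1.2).2.1
  -- transfer of the (outer) measures: `P (W ∩ A₀ ∩ (X ∩ E)) = P (F ∩ A)` when `A₀, A` agree on `good ∩ W`
  have hK1 : ∀ A₀ A : Set (Config (N + 1) (Fin 3) T3), MeasurableSet A →
      (∀ z ∈ Φ.good, z ∈ W → (z ∈ A₀ ↔ z ∈ A)) → P (W ∩ A₀ ∩ F₀) = P (F ∩ A) := by
    intro A₀ A hAm hiff
    have hAm' : MeasurableSet ((Φ.good ∩ W) ∩ A) := hW'.inter hAm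
    have hsd : symmDiff (W ∩ A₀) ((Φ.good ∩ W) ∩ A) ⊆ Φ.goodᶜ := by
      intro z hz hzg
      rcases hz with ⟨⟨hzW, hzA⟩, hnot⟩ | ⟨⟨⟨-, hzW⟩, hzA⟩, hnot⟩
      · exact hnot ⟨⟨hzg, hzW⟩, (hiff z hzg hzW).1 hzA⟩
      · exact hnot ⟨hzW, (hiff z hzg hzW).2 hzA⟩
    calc P (W ∩ A₀ ∩ F₀) = P (F₀ ∩ (W ∩ A₀)) := by rw [Set.inter_comm]
      _ = P (F₀ ∩ ((Φ.good ∩ W) ∩ A)) := measure_inter_congr_of_symmDiff_null P Φ.goodᶜ hnull hsd F₀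
      _ = P (((Φ.good ∩ W) ∩ A) ∩ F₀) := by rw [Set.inter_comm]
      _ = P.restrict F₀ ((Φ.good ∩ W) ∩ A) := (Measure.restrict_apply hAm').symm
      _ = P.restrict Fm ((Φ.good ∩ W) ∩ A) := by rw [hresF]
      _ = P (((Φ.good ∩ W) ∩ A) ∩ Fm) := Measure.restrict_apply hAm'
      _ = P (F ∩ A) := by rw [hFdef, Set.inter_right_comm]
  -- transfer of the restricted measure: `P|(W ∩ (X ∩ E)) = P|F`
  have hK2 : P.restrict (W ∩ F₀) = P.restrict F := by
    have hae : (W ∩ F₀ : Set (Config (N + 1) (Fin 3) T3)) =ᵐ[P] ((Φ.good ∩ W) ∩ F₀ : Set _) := by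
      refine ae_eq_set.2 ⟨?_, ?_⟩
      · exact measure_mono_null (fun z hz hg => hz.2 ⟨⟨hg, hz.1.1⟩, hz.1.2⟩) hnull
      · have : ((Φ.good ∩ W) ∩ F₀) \ (W ∩ F₀) = (∅ : Set (Config (N + 1) (Fin 3) T3)) := by
          ext z
          simp only [mem_sdiff, mem_inter_iff, mem_empty_iff_false, iff_false]
          tauto
        rw [this, measure_empty]
    rw [Measure.restrict_congr_set hae, ← Measure.restrict_restrict hW', ← hresF, Measure.restrict_restrict hW', hFdef]
  -- (3) the brick's hypothesis for `(P, F, g', b')`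
  have hyp : ∀ (δ : V3) (S' : Set (V3 × V3)), MeasurableSet S' →
      |P.real (F ∩ {z | (g' z, b' z) ∈ S' ∧ (inner ℝ (b' z) (g' z) = 0 ∧ ‖b' z‖ < 1) ∧
          (inner ℝ (b' z - (δ - inner ℝ δ (g' z) • g' z)) (g' z) = 0 ∧ ‖b' z - (δ - inner ℝ δ (g' z) • g' z)‖ < 1)}) -
        P.real (F ∩ {z | (g' z, b' z + (δ - inner ℝ δ (g' z) • g' z)) ∈ S' ∧
          (inner ℝ (b' z + (δ - inner ℝ δ (g' z) • g' z)) (g' z) = 0 ∧ ‖b' z + (δ - inner ℝ δ (g' z) • g' z)‖ < 1) ∧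
          (inner ℝ (b' z) (g' z) = 0 ∧ ‖b' z‖ < 1)})| ≤ η := by
    intro δ S' hS'
    have e1 := hK1 {z | (gIn z, bOff z) ∈ S' ∧ (inner ℝ (bOff z) (gIn z) = 0 ∧ ‖bOff z‖ < 1) ∧
        (inner ℝ (bOff z - (δ - inner ℝ δ (gIn z) • gIn z)) (gIn z) = 0 ∧
          ‖bOff z - (δ - inner ℝ δ (gIn z) • gIn z)‖ < 1)} _ (measurableSet_shiftEvent₁ hg'm hb'm δ hS')
      (fun z hz _ => by simp only [mem_setOf_eq, hg'eq z hz, hb'eq z hz])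
    have e2 := hK1 {z | (gIn z, bOff z + (δ - inner ℝ δ (gIn z) • gIn z)) ∈ S' ∧
        (inner ℝ (bOff z + (δ - inner ℝ δ (gIn z) • gIn z)) (gIn z) = 0 ∧
          ‖bOff z + (δ - inner ℝ δ (gIn z) • gIn z)‖ < 1) ∧
        (inner ℝ (bOff z) (gIn z) = 0 ∧ ‖bOff z‖ < 1)} _ (measurableSet_shiftEvent₂ hg'm hb'm δ hS')
      (fun z hz _ => by simp only [mem_setOf_eq, hg'eq z hz, hb'eq z hz])
    rw [measureReal_def, measureReal_def, ← e1, ← e2]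
    exact hTQI δ S' hS'
  have hbrick := disc_flat_bundle_of_quasiInvariant P hg'm hb'm hFm' hunit hη.le hyp hS
  -- (4a) removing the disc constraint from the event costs `P(goodᶜ ∪ L) ≤ η`
  have ha : |(P (W ∩ {z | (gIn z, bOff z) ∈ S} ∩ F₀)).toReal -
      (P (W ∩ {z | (gIn z, bOff z) ∈ S ∧ (inner ℝ (bOff z) (gIn z) = 0 ∧ ‖bOff z‖ < 1)} ∩ F₀)).toReal| ≤ η := by
    have hsd : symmDiff (W ∩ {z | (gIn z, bOff z) ∈ S})
        (W ∩ {z | (gIn z, bOff z) ∈ S ∧ (inner ℝ (bOff z) (gIn z) = 0 ∧ ‖bOff z‖ < 1)}) ⊆ Φ.goodᶜ ∪ L := by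
      intro z hz
      by_contra hcon
      simp only [mem_union, mem_compl_iff, not_or, not_not] at hcon
      obtain ⟨hzg, hzL⟩ := hcon
      rcases hz with ⟨⟨hzW, hzA⟩, hnot⟩ | ⟨⟨hzW, hzA⟩, hnot⟩
      · exact hnot ⟨hzW, hzA, hdisc z hzg hzW hzL⟩
      · exact hnot ⟨hzW, hzA.1⟩
    exact (abs_toReal_measure_inter_sub_le P F₀ hsd).trans hbad
  -- (4b) the disc event has the same mass for `(gIn, bOff)` on `W ∩ (X ∩ E)` and for `(g', b')` on `F`
  have hb : (P (W ∩ {z | (gIn z, bOff z) ∈ S ∧ (inner ℝ (bOff z) (gIn z) = 0 ∧ ‖bOff z‖ < 1)} ∩ F₀)).toReal =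
      P.real (F ∩ {z | (g' z, b' z) ∈ S ∧ (inner ℝ (b' z) (g' z) = 0 ∧ ‖b' z‖ < 1)}) := by
    rw [measureReal_def, hK1 _ _ (measurableSet_discEvent hg'm hb'm hS)
      (fun z hz _ => by simp only [mem_setOf_eq, hg'eq z hz, hb'eq z hz])]
  -- (4c) the compensators agree
  have hc : ∫ z in W ∩ F₀, discLaw (gIn z) {b | (gIn z, b) ∈ S} ∂P = ∫ z in F, discLaw (g' z) {u | (g' z, u) ∈ S} ∂P := by
    rw [hK2]
    exact setIntegral_congr_fun hFm' fun z hz => by rw [hg'eq z hz.1.1]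
  -- (4d) removing the disc constraint from the compensator costs `P(goodᶜ ∪ L) ≤ η`
  have hd : |∫ z in F, discLaw (g' z) {u | (g' z, u) ∈ S} ∂P -
      ∫ z in F ∩ {z | inner ℝ (b' z) (g' z) = 0 ∧ ‖b' z‖ < 1}, discLaw (g' z) {u | (g' z, u) ∈ S} ∂P| ≤ η := by
    have hDm : MeasurableSet {z | inner ℝ (b' z) (g' z) = 0 ∧ ‖b' z‖ < 1} :=
      measurableSet_discBundle.preimage (hg'm.prodMk hb'm)
    have hInt : IntegrableOn (fun z => discLaw (g' z) {u | (g' z, u) ∈ S}) F P :=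
      (integrable_const (1 : ℝ)).mono' (measurable_discLaw_comp hg'm hS).aestronglyMeasurable
        (ae_of_all _ fun z => by
          rw [Real.norm_eq_abs, abs_of_nonneg (discLaw_nonneg _ _)]
          exact discLaw_le_one _ _)
    have hsplit := integral_inter_add_sdiff hDm hInt
    have hsub : (Φ.good ∩ W) \ {z | inner ℝ (b' z) (g' z) = 0 ∧ ‖b' z‖ < 1} ⊆ Φ.goodᶜ ∪ L := by
      intro z hz
      by_contra hcon
      simp only [mem_union, mem_compl_iff, not_or, not_not] at hcon
      obtain ⟨hzg, hzL⟩ := hcon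
      apply hz.2
      show inner ℝ (b' z) (g' z) = 0 ∧ ‖b' z‖ < 1
      rw [hg'eq z hzg, hb'eq z hzg]
      exact hdisc z hzg hz.1.2 hzL
    have hm : MeasurableSet ((Φ.good ∩ W) \ {z | inner ℝ (b' z) (g' z) = 0 ∧ ‖b' z‖ < 1}) := hW'.diff hDm
    have hsmall : P (F \ {z | inner ℝ (b' z) (g' z) = 0 ∧ ‖b' z‖ < 1}) ≤ P (Φ.goodᶜ ∪ L) := by
      calc P (F \ {z | inner ℝ (b' z) (g' z) = 0 ∧ ‖b' z‖ < 1})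
          = P (((Φ.good ∩ W) \ {z | inner ℝ (b' z) (g' z) = 0 ∧ ‖b' z‖ < 1}) ∩ Fm) := by
            rw [hFdef, Set.sdiff_eq, Set.sdiff_eq, Set.inter_right_comm]
        _ = P.restrict F₀ ((Φ.good ∩ W) \ {z | inner ℝ (b' z) (g' z) = 0 ∧ ‖b' z‖ < 1}) := by
            rw [← hresF, Measure.restrict_apply hm]
        _ = P (((Φ.good ∩ W) \ {z | inner ℝ (b' z) (g' z) = 0 ∧ ‖b' z‖ < 1}) ∩ F₀) := Measure.restrict_apply hm
        _ ≤ P ((Φ.good ∩ W) \ {z | inner ℝ (b' z) (g' z) = 0 ∧ ‖b' z‖ < 1}) := measure_mono Set.inter_subset_left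
        _ ≤ P (Φ.goodᶜ ∪ L) := measure_mono hsub
    have hrest : |∫ z in F \ {z | inner ℝ (b' z) (g' z) = 0 ∧ ‖b' z‖ < 1}, discLaw (g' z) {u | (g' z, u) ∈ S} ∂P| ≤ η := by
      have h1 := norm_setIntegral_le_of_norm_le_const (measure_lt_top P _)
        (fun z _ => show ‖discLaw (g' z) {u | (g' z, u) ∈ S}‖ ≤ 1 by
          rw [Real.norm_eq_abs, abs_of_nonneg (discLaw_nonneg _ _)]
          exact discLaw_le_one _ _)
        (f := fun z => discLaw (g' z) {u | (g' z, u) ∈ S}) (μ := P)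
        (s := F \ {z | inner ℝ (b' z) (g' z) = 0 ∧ ‖b' z‖ < 1})
      rw [Real.norm_eq_abs, one_mul, measureReal_def] at h1
      exact h1.trans ((ENNReal.toReal_mono (measure_ne_top _ _) hsmall).trans hbad)
    rw [← hsplit, add_sub_cancel_left]
    exact hrest
  -- (5) assemble
  rw [hc]
  calc |(P (W ∩ {z | (gIn z, bOff z) ∈ S} ∩ F₀)).toReal - ∫ z in F, discLaw (g' z) {u | (g' z, u) ∈ S} ∂P|
      ≤ |(P (W ∩ {z | (gIn z, bOff z) ∈ S} ∩ F₀)).toReal -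
            (P (W ∩ {z | (gIn z, bOff z) ∈ S ∧ (inner ℝ (bOff z) (gIn z) = 0 ∧ ‖bOff z‖ < 1)} ∩ F₀)).toReal| +
          (|(P (W ∩ {z | (gIn z, bOff z) ∈ S ∧ (inner ℝ (bOff z) (gIn z) = 0 ∧ ‖bOff z‖ < 1)} ∩ F₀)).toReal -
              ∫ z in F ∩ {z | inner ℝ (b' z) (g' z) = 0 ∧ ‖b' z‖ < 1}, discLaw (g' z) {u | (g' z, u) ∈ S} ∂P| +
            |∫ z in F ∩ {z | inner ℝ (b' z) (g' z) = 0 ∧ ‖b' z‖ < 1}, discLaw (g' z) {u | (g' z, u) ∈ S} ∂P -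
              ∫ z in F, discLaw (g' z) {u | (g' z, u) ∈ S} ∂P|) :=
        (abs_sub_le _ _ _).trans (add_le_add le_rfl (abs_sub_le _ _ _))
    _ ≤ η + (36 * η + η) := by
        refine add_le_add ha (add_le_add ?_ ?_)
        · rw [hb]; exact hbrick
        · rw [abs_sub_comm]; exact hd
    _ = 38 * C * σ ^ p := by rw [hηdef]; ring

end

end Summit.AtomisticToContinuum.HydrodynamicLimit.Theorems.OLC
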